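import Literature.NumberTheory.GaloisRepresentations.CharacterPeriodsAdmissible
import HarnessLib

/-!
# Compatible families of periods from periods for the stabilisers (orbit induction)

Topic `NumberTheory/GaloisRepresentations`; namespace `Literature.NumberTheory.GaloisRepresentations`.
Continuation of `CharacterPeriodsAdmissible`.  There, a character `ψ : Γ_F → Eˣ` with coefficients in
a finite `E/ℚ_p` was shown to be `𝔅`-admissible (for a period-ring datum `𝔅` over `ℚ_p` with
invariants `F` receiving `F̄` equivariantly through `ι`) as soon as it has a COMPATIBLE FAMILY of
periods `y_j ∈ B ∖ {0}`, `j` running over the `ℚ_p`-embeddings `E → F̄`: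
`y_{σ∘j} = ι((σ∘j)(ψ σ)) · σ(y_j)` for all `σ ∈ Γ_F`.  In practice periods come ONE STABILISER AT A
TIME: for each embedding `j` one constructs some `z_j ≠ 0` on which the open subgroup
`Stab(j) = {h | h∘j = j} = Γ_{F·j(E)}` acts through `(j∘ψ)⁻¹`, i.e. `z_j = ι(j(ψ h)) · h(z_j)` for
`h∘j = j` (for a Lubin–Tate character: `z_j = 1/t_{π,j}`), with no relation between `z_j` and
`z_{σ∘j}`.  This file performs the (elementary) induction along the orbits of `Γ_F` on the
embeddings which upgrades such data to a compatible family (Fontaine 1994, Exp. III §1.5, the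
computation of `D_B` of an induced/`E`-linear representation embedding by embedding; Serre 1968,
Ch. III App. A; Conrad 2011, App. B):

* `exists_compatibleFamily_of_stabilizer` — ABSTRACT FORM [folklore]: a group `Γ` acting on a set
  `J` and by ring automorphisms on a domain `B`, a "cocycle" `a : Γ → J → B ∖ {0}` with
  `a(στ, j) = a(σ, τj) · σ(a(τ, j))`, and `z : J → B ∖ {0}` with `z_j = a(h, j) · h(z_j)` whenever
  `h j = j`; then there is `y : J → B ∖ {0}` with `y_{σj} = a(σ, j) · σ(y_j)` for ALL `σ, j`
  (`y_j = a(m_j, j₀) · m_j(z_{j₀})` for a representative `j₀` of the orbit of `j` and any `m_j` with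
  `m_j j₀ = j`; independence of the choices is exactly the stabiliser condition).
* `absGalEmbAction` — the action `σ • j = σ ∘ j` of `Γ_F` on `E →ₐ[ℚ_p] F̄` (accepted
  `absGalEmbComp`) as a `MulAction` (a `def`, activated locally).
* `PeriodRingData.isAdmissible_of_stabilizerPeriods` — `𝔅`-admissibility of `ρ ≃ (E, ψ)` from
  stabiliser periods `z_j` (the cocycle is `a(σ, j) = ι((σ∘j)(ψ σ))`; then the accepted
  `PeriodRingData.isAdmissible_of_characterPeriods`).
* `FramedRep.isDeRhamWith_of_stabilizerPeriods` — framed form for `r : Γ_F →ₜ* GL₁(ℚ̄_p)` with a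
  model `rE` over a finite `E ⊆ ℚ̄_p` (accepted `HasQlModel`, `FramedRep.IsDeRhamWith`).

## References

* [FontaineAsterisque223III] J.-M. Fontaine, *Représentations p-adiques semi-stables*, Astérisque
  223 (1994), Exp. III §1.5 (Prop. 1.5.2) and §3.
* [SerreAbelianLadic1968] J.-P. Serre, *Abelian ℓ-adic representations and elliptic curves* (1968),
  Ch. III, App. A (characters with coefficients, embedding by embedding).
* [Conrad2011LiftingGlobal] B. Conrad, *Lifting global representations with local properties*
  (2011), App. B.
-/

noncomputable section

open Field MulAction
open scoped MatrixGroups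

namespace Literature.NumberTheory.GaloisRepresentations

universe u w w'

/-! ### Abstract orbit induction -/

/-- **Compatible families from stabiliser data** (orbit induction).  Let `Γ` act on a set `J` and by
ring automorphisms on a domain `B`; let `a : Γ → J → B ∖ {0}` satisfy the cocycle identity
`a(στ, j) = a(σ, τ j) · σ(a(τ, j))`, and let `z : J → B ∖ {0}` satisfy `z_j = a(h, j) · h(z_j)`
whenever `h j = j`.  Then some `y : J → B ∖ {0}` satisfies `y_{σ j} = a(σ, j) · σ(y_j)` for all
`σ`, `j`: transport `z` from one representative per orbit. [folklore] -/
theorem exists_compatibleFamily_of_stabilizer {Γ J B : Type*} [Group Γ] [MulAction Γ J]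
    [CommRing B] [NoZeroDivisors B] [MulSemiringAction Γ B]
    (a : Γ → J → B) (ha : ∀ (σ τ : Γ) (j : J), a (σ * τ) j = a σ (τ • j) * σ • a τ j)
    (ha0 : ∀ σ j, a σ j ≠ 0)
    (z : J → B) (hz0 : ∀ j, z j ≠ 0)
    (hz : ∀ (j : J) (h : Γ), h • j = j → z j = a h j * h • z j) :
    ∃ y : J → B, (∀ j, y j ≠ 0) ∧ ∀ (σ : Γ) (j : J), y (σ • j) = a σ j * σ • y j := by
  classical
  -- a representative `rep j` of the orbit of `j`, constant on orbits
  let rep : J → J := fun j => Quotient.out (Quotient.mk (orbitRel Γ J) j : orbitRel.Quotient Γ J)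
  have hrep : ∀ j, ∃ σ : Γ, σ • rep j = j := by
    intro j
    have h1 : rep j ∈ orbit Γ j := by
      rw [← orbitRel_apply]
      exact Quotient.mk_out (s := orbitRel Γ J) j
    obtain ⟨σ, hσ⟩ := mem_orbit_iff.mp h1
    exact ⟨σ⁻¹, by rw [← hσ, inv_smul_smul]⟩
  have hrep_smul : ∀ (σ : Γ) (j : J), rep (σ • j) = rep j := by
    intro σ j
    simp only [rep]
    congr 1
    apply Quotient.sound
    show σ • j ∈ orbit Γ j
    exact mem_orbit _ _
  -- an element `mv j` moving `rep j` to `j`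
  choose mv hmv using hrep
  refine ⟨fun j => a (mv j) (rep j) * mv j • z (rep j), ?_, ?_⟩
  · intro j
    refine mul_ne_zero (ha0 _ _) fun h0 => hz0 (rep j) ?_
    have := congrArg (fun b => (mv j)⁻¹ • b) h0
    simpa using this
  · intro σ j
    -- `mv (σ • j)` and `σ * mv j` both move `rep j` to `σ • j`: their quotient stabilises `rep j`
    have hst : ((σ * mv j)⁻¹ * mv (σ • j)) • rep j = rep j := by
      have h1 : mv (σ • j) • rep j = σ • j := by rw [← hrep_smul σ j]; exact hmv (σ • j)
      have h2 : σ • j = (σ * mv j) • rep j := by rw [mul_smul, hmv]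
      rw [mul_smul, h1, h2, inv_smul_smul]
    have hdec : mv (σ • j) = σ * mv j * ((σ * mv j)⁻¹ * mv (σ • j)) := by group
    have key : ∀ h : Γ, h • rep j = rep j →
        a (σ * mv j * h) (rep j) * (σ * mv j * h) • z (rep j) =
          a σ j * σ • (a (mv j) (rep j) * mv j • z (rep j)) := by
      intro h hh
      rw [ha, ha, mul_smul (σ * mv j) h, hh, hmv j]
      conv_rhs => rw [hz (rep j) h hh]
      simp only [smul_mul', mul_smul]
      ring
    simp only
    rw [hrep_smul σ j]
    conv_lhs => rw [hdec]
    exact key _ hst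

/-! ### The action of `Γ_F` on the `ℚ_p`-embeddings `E → F̄` -/

section Embeddings

variable {F : Type u} [Field F] {p : ℕ} [Fact p.Prime] [Algebra ℚ_[p] F]
  {E : Type*} [Field E] [Algebra ℚ_[p] E]

/-- **`Γ_F` acts on the `ℚ_p`-embeddings `E → F̄` by post-composition**, `σ • j = σ ∘ j`
(accepted `absGalEmbComp`), as a `MulAction`; a `def`, to be activated locally
(`attribute [local instance] absGalEmbAction`). [folklore] -/
@[reducible] def absGalEmbAction : MulAction (absoluteGaloisGroup F) (E →ₐ[ℚ_[p]] AlgebraicClosure F) where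
  smul := absGalEmbComp
  one_smul := absGalEmbComp_one
  mul_smul := absGalEmbComp_mul

attribute [local instance] absGalEmbAction

/-- Unfolding: `σ • j = σ ∘ j`. [folklore] -/
theorem absGalEmbAction_smul (σ : absoluteGaloisGroup F) (j : E →ₐ[ℚ_[p]] AlgebraicClosure F) :
    σ • j = absGalEmbComp σ j := rfl

/-- The stabiliser of `j` is `{h | h ∘ j = j}`, i.e. `h` fixes `j(E)` pointwise. [folklore] -/
theorem mem_stabilizer_absGalEmb_iff (h : absoluteGaloisGroup F) (j : E →ₐ[ℚ_[p]] AlgebraicClosure F) :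
    h ∈ stabilizer (absoluteGaloisGroup F) j ↔ ∀ x : E, h • j x = j x := by
  rw [mem_stabilizer_iff, absGalEmbAction_smul]
  refine ⟨fun hh x => ?_, fun hh => AlgHom.ext fun x => by rw [absGalEmbComp_apply, hh]⟩
  rw [← absGalEmbComp_apply, hh]

end Embeddings

/-! ### Admissibility from stabiliser periods -/

section Character

variable {F : Type u} [Field F] {p : ℕ} [Fact p.Prime] [Algebra ℚ_[p] F]

attribute [local instance] absGalEmbAction

-- Mathlib's own global value of `maxSynthPendingDepth` (see `PeriodRingData.rank_D_le`).
set_option maxSynthPendingDepth 3 in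
/-- **A character with coefficients in `E` is `B`-admissible as soon as every embedding has a
stabiliser period.**  Setting as in `PeriodRingData.isAdmissible_of_characterPeriods`
(`𝔅` a period-ring datum for `Γ_F` over `ℚ_p` with invariants `F`, `ι : F̄ → B` equivariant
extending `F → B`, `ρ ≃ (E, ψ)` through `θ`), with `ψ` multiplicative and non-vanishing.  If for
every `ℚ_p`-embedding `j : E → F̄` there is `z_j ∈ B ∖ {0}` with `z_j = ι(j(ψ h)) · h(z_j)` for all
`h ∈ Γ_F` with `h ∘ j = j` (i.e. `Stab(j) = Γ_{F·j(E)}` acts on `z_j` through `(j ∘ ψ)⁻¹`), then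
`ρ` is `𝔅`-admissible: orbit induction (`exists_compatibleFamily_of_stabilizer` with the cocycle
`a(σ, j) = ι((σ∘j)(ψ σ))`) produces a compatible family, and the accepted
`isAdmissible_of_characterPeriods` applies.
[cite: FontaineAsterisque223III, Exp. III §1.5 and Prop. 1.5.2]
[cite: Conrad2011LiftingGlobal, Appendix B] -/
theorem PeriodRingData.isAdmissible_of_stabilizerPeriods
    (𝔅 : PeriodRingData.{u, 0, u, w} (absoluteGaloisGroup F) ℚ_[p] F)
    (ι : AlgebraicClosure F →+* 𝔅.B)
    (hισ : ∀ (σ : absoluteGaloisGroup F) (x : AlgebraicClosure F), σ • ι x = ι (σ • x))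
    (hιa : ∀ a : F, ι (algebraMap F (AlgebraicClosure F) a) = algebraMap F 𝔅.B a)
    {E : Type*} [Field E] [Algebra ℚ_[p] E] [FiniteDimensional ℚ_[p] E]
    {V : Type w'} [AddCommGroup V] [Module ℚ_[p] V] [TopologicalSpace V] [FiniteDimensional ℚ_[p] V]
    (ρ : ContinuousRep (absoluteGaloisGroup F) ℚ_[p] V) (ψ : absoluteGaloisGroup F → E)
    (hψ : ∀ σ τ, ψ (σ * τ) = ψ σ * ψ τ) (hψ0 : ∀ σ, ψ σ ≠ 0)
    (θ : E ≃ₗ[ℚ_[p]] V) (hρ : ∀ (σ : absoluteGaloisGroup F) (c : E), ρ σ (θ c) = θ (ψ σ * c))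
    (z : (E →ₐ[ℚ_[p]] AlgebraicClosure F) → 𝔅.B) (hz0 : ∀ j, z j ≠ 0)
    (hz : ∀ (j : E →ₐ[ℚ_[p]] AlgebraicClosure F) (h : absoluteGaloisGroup F),
      absGalEmbComp h j = j → z j = ι (j (ψ h)) * h • z j) :
    𝔅.IsAdmissible ρ := by
  have ha : ∀ (σ τ : absoluteGaloisGroup F) (j : E →ₐ[ℚ_[p]] AlgebraicClosure F),
      ι (absGalEmbComp (σ * τ) j (ψ (σ * τ))) =
        ι (absGalEmbComp σ (absGalEmbComp τ j) (ψ σ)) * σ • ι (absGalEmbComp τ j (ψ τ)) := by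
    intro σ τ j
    rw [hψ, map_mul (absGalEmbComp (σ * τ) j), map_mul ι, absGalEmbComp_mul, hισ]
    rfl
  have ha0 : ∀ (σ : absoluteGaloisGroup F) (j : E →ₐ[ℚ_[p]] AlgebraicClosure F),
      ι (absGalEmbComp σ j (ψ σ)) ≠ 0 := fun σ j =>
    (map_ne_zero ι).mpr ((map_ne_zero _).mpr (hψ0 σ))
  have hz' : ∀ (j : E →ₐ[ℚ_[p]] AlgebraicClosure F) (h : absoluteGaloisGroup F), h • j = j →
      z j = ι (absGalEmbComp h j (ψ h)) * h • z j := by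
    intro j h hh
    rw [absGalEmbAction_smul] at hh
    rw [show absGalEmbComp h j = j from hh]
    exact hz j h hh
  obtain ⟨y, hy0, hy⟩ := exists_compatibleFamily_of_stabilizer
    (fun (σ : absoluteGaloisGroup F) (j : E →ₐ[ℚ_[p]] AlgebraicClosure F) =>
      ι (absGalEmbComp σ j (ψ σ))) ha ha0 z hz0 hz'
  exact 𝔅.isAdmissible_of_characterPeriods ι hισ hιa ρ ψ θ hρ y hy0 fun σ j => hy σ j

end Character

/-! ### Framed form -/

section Framed

variable {F : Type} [Field F] {p : ℕ} [Fact p.Prime]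

/-- `σ ↦ rE(σ)₀₀` is multiplicative (rank one). [folklore] -/
theorem FramedRep.apply_zero_zero_mul {E : IntermediateField ℚ_[p] (PadicAlgCl p)}
    (rE : FramedRep (absoluteGaloisGroup F) E 1) (σ τ : absoluteGaloisGroup F) :
    (((rE (σ * τ) : GL (Fin 1) E) : Matrix (Fin 1) (Fin 1) E) 0 0) =
      (((rE σ : GL (Fin 1) E) : Matrix (Fin 1) (Fin 1) E) 0 0) *
        (((rE τ : GL (Fin 1) E) : Matrix (Fin 1) (Fin 1) E) 0 0) := by
  rw [map_mul, Units.val_mul, Matrix.mul_apply, Fin.sum_univ_one]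

/-- `rE(σ)₀₀ ≠ 0` (it is the determinant of an invertible `1 × 1` matrix). [folklore] -/
theorem FramedRep.apply_zero_zero_ne_zero {E : IntermediateField ℚ_[p] (PadicAlgCl p)}
    (rE : FramedRep (absoluteGaloisGroup F) E 1) (σ : absoluteGaloisGroup F) :
    (((rE σ : GL (Fin 1) E) : Matrix (Fin 1) (Fin 1) E) 0 0) ≠ 0 := by
  have h := Units.isUnit (rE σ : GL (Fin 1) E)
  rw [Matrix.isUnit_iff_isUnit_det, Matrix.det_fin_one, isUnit_iff_ne_zero] at h
  exact h

-- Mathlib's own global value of `maxSynthPendingDepth` (see `PeriodRingData.rank_D_le`).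
set_option maxSynthPendingDepth 3 in
/-- **A rank-one `r : Γ_F →ₜ* GL₁(ℚ̄_p)` with stabiliser periods is de Rham for `(alg, 𝔅)`.**
As `FramedRep.isDeRhamWith_of_characterPeriods`, but the periods are required one stabiliser at a
time: for every `ℚ_p`-embedding `j : E → F̄` of the coefficient field of a model `rE` of `r`, some
`z_j ∈ B ∖ {0}` with `z_j = ι(j(ψ h)) · h(z_j)` whenever `h ∘ j = j`, where `ψ(σ) = rE(σ)₀₀`.
[cite: FontaineAsterisque223III, Exp. III §1.5 and Prop. 1.5.2]
[cite: Conrad2011LiftingGlobal, Appendix B] -/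
theorem FramedRep.isDeRhamWith_of_stabilizerPeriods (alg : Algebra ℚ_[p] F)
    (𝔅 : PeriodRingData.{0, 0, 0, 0} (absoluteGaloisGroup F) ℚ_[p] F)
    (ι : AlgebraicClosure F →+* 𝔅.B)
    (hισ : ∀ (σ : absoluteGaloisGroup F) (x : AlgebraicClosure F), σ • ι x = ι (σ • x))
    (hιa : ∀ a : F, ι (algebraMap F (AlgebraicClosure F) a) = algebraMap F 𝔅.B a)
    (r : FramedRep (absoluteGaloisGroup F) (PadicAlgCl p) 1)
    {E : IntermediateField ℚ_[p] (PadicAlgCl p)} [FiniteDimensional ℚ_[p] E]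
    {rE : FramedRep (absoluteGaloisGroup F) E 1}
    (hmodel : Literature.NumberTheory.Automorphic.HasQlModel r E rE)
    (z : (E →ₐ[ℚ_[p]] AlgebraicClosure F) → 𝔅.B) (hz0 : ∀ j, z j ≠ 0)
    (hz : ∀ (j : E →ₐ[ℚ_[p]] AlgebraicClosure F) (h : absoluteGaloisGroup F),
      absGalEmbComp h j = j →
        z j = ι (j ((((rE h : GL (Fin 1) E) : Matrix (Fin 1) (Fin 1) E) 0 0))) * h • z j) :
    r.IsDeRhamWith alg 𝔅 := by
  haveI : ContinuousSMul ℚ_[p] E := IntermediateField.continuousSMul_padicAlgCl E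
  refine ⟨E, ‹_›, rE, hmodel, ?_⟩
  exact 𝔅.isAdmissible_of_stabilizerPeriods ι hισ hιa
    (Literature.NumberTheory.Automorphic.restrictScalarsQl E rE)
    (fun σ => (((rE σ : GL (Fin 1) E) : Matrix (Fin 1) (Fin 1) E) 0 0))
    (fun σ τ => rE.apply_zero_zero_mul σ τ) (fun σ => rE.apply_zero_zero_ne_zero σ)
    (LinearEquiv.funUnique (Fin 1) ℚ_[p] E).symm
    (fun σ c => restrictScalarsQl_apply_funUnique_symm rE σ c) z hz0 hz

end Framed

end Literature.NumberTheory.GaloisRepresentations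

end
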